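import Summits.HodgeConjecture.CorCM.IrreducibleOddWeightsCanonicalPivotTraceSharp
import HarnessLib

/-!
# Canonical pivot, XIV: THE EXACT TYPE-FREE CRITERION WHEN ONE FIELD IS GALOIS — `Hg(A₀ × A₁) = Hg(A₀) × Hg(A₁)` for
# ALL CM types of `K₀` and of a Galois CM field `K₁` **iff** the trace `K₀ ∩ K₁` lies in the maximal real subfield `K₀⁺`

COR-CM (cell `pub-hodgecm2`, binder seat `b16` gen 66, count-neutral claim TRACE COUNT, file T4 — CM fields; theorems
only, no definition, no named fact, no `sorry`).  NEW as stated, hence under `Summits/`.  HONEST FRAMING: an exact,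
unconditional criterion about `dim MT(A₀ × A₁)` for abelian varieties with complex multiplication, one of whose CM fields
is Galois over `ℚ`; nothing is claimed about the algebraicity of Hodge classes; `HC_CM` is neither used nor asserted.

THE THEOREM (**`forall_cmFamilyRank_add_card_eq_iff_trace_le_maximalRealSubfield`**).  `K_{i₀}` any CM field, `K_{i₁}` a
CM field NORMAL over `ℚ`, `a₀ : K_{i₀} → ℂ` any embedding.  Then

  `(∀ types Φ₀, Φ₁: cmFamilyRank (Φ₀, Φ₁) + 2 = cmTypeRank Φ₀ + cmTypeRank Φ₁ + 1)   ↔   a₀⁻¹(L₁) ≤ K_{i₀}⁺`,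

i.e. **`Hg(A₀ × A₁) = Hg(A₀) × Hg(A₁)` for every pair of realisations iff the trace `a₀(K_{i₀}) ∩ L₁` (`L₁ = b(K_{i₁})`
for any `b`, `K_{i₁}` being normal) is fixed by complex conjugation.**  `⟸` is gen 65's trace criterion (one embedding,
T2).  `⟹` (**`exists_cmFamilyRank_add_card_lt_of_not_mem_maximalRealSubfield`**): if some `k₀` of the trace field
`T = a₀⁻¹(L₁) ≤ K_{i₀}` is moved by `ρ`, then NO embedding of `T` is real (§1, via T1), so `T` carries a CM type `φ`
(**`nonempty_cmType_of_forall_conjugate_ne`** — choose the smaller of `s, s̄` in any enumeration); `T` embeds into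
`K_{i₀}` (inclusion) and into `K_{i₁}` (**`nonempty_ringHom_trace_of_normal`**: `a₀(T) ⊆ L₁ = b(K_{i₁})`), and the induced
pair `(φ^{K₀}, φ^{K₁})` has defect `cmTypeRank φ − 1 ≥ 1` (T2 `cmTypeRank_add_cmTypeRank_inducedCMType_pair` with
**`two_le_cmTypeRank_of_cmType`**, the rank bound for any CM type of any field with an embedding).  The census of the
seat (job j234139: 530 Galois-slot configurations in the closures of all CM Galois types of degree `≤ 8`) has no
exception, as it must.  By symmetry the same holds with `K_{i₀}` normal (**`…_iff_trace_le_maximalRealSubfield'`**), and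
for two Galois CM fields additivity for all types is equivalent to `K₀ ∩ K₁ ⊆ ℂ` being fixed by conjugation
(**`forall_cmFamilyRank_add_card_eq_iff_of_normal_of_normal`**).  For NON-Galois pairs the criterion is false in both
directions of refinement: additivity for all types is strictly weaker than a real trace and than (PC) (positional
additivity: 49 of 1591 non-Galois configurations of the census, all of equal degrees), cf. the card TRACE-CENSUS.md.

## References

* [Gordon1999HodgeAVSurvey] B. B. Gordon, *A survey of the Hodge conjecture for abelian varieties*, §3 Theorem (proof),
  7.5–7.7, 7.6.1.
* [Shimura1998] G. Shimura, *Abelian Varieties with Complex Multiplication and Modular Functions*, §8.2 Prop. 26, §18.2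
  Lemma, §32.9.
* [MoonenZarhin1999LowDim] B. Moonen, Yu. Zarhin, *Hodge classes on abelian varieties of low dimension*, Thm. (0.2), §3 (3.1).
* [Lang2002] S. Lang, *Algebra*, GTM 211, V §2 Thm. 2.8, VI §1 Thm. 1.12.
-/

set_option autoImplicit false

noncomputable section

open scoped BigOperators Classical

open CategoryTheory CategoryTheory.Limits NumberField NumberField.ComplexEmbedding Module IntermediateField

namespace Summit.HodgeConjecture.CorCM

open Literature.NumberTheory.ComplexMultiplication
open Literature.AlgebraicGeometry.Motives (AbelianVariety CMType)
open Literature.AlgebraicGeometry.Motives.AbelianVariety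
open Literature.AlgebraicGeometry.HodgeTheory
open Literature.AlgebraicGeometry.ComplexMultiplication (IsCMTypeRealisation)
open Literature.AlgebraicGeometry.Pohlmann1968

/-! ### §1 CM types of a field without real embeddings; the rank of any CM type is at least `2` -/

section Generic

variable {E : Type} [Field E] [NumberField E]

/-- **A number field none of whose complex embeddings is real carries a CM type**: enumerate the embeddings and keep,
of each pair `{s, s̄}` (`s̄ ≠ s`), the one with the smaller index. [cite: Shimura1998, §8.2 Prop. 26]
[cite: Lang2002, VI §1 Thm. 1.12] -/
theorem nonempty_cmType_of_forall_conjugate_ne (h : ∀ s : E →+* ℂ, conjugate s ≠ s) : Nonempty (CMType E) := by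
  let f : (E →+* ℂ) ≃ Fin (Fintype.card (E →+* ℂ)) := Fintype.equivFin (E →+* ℂ)
  refine ⟨⟨{s | f s < f (conjugate s)}, fun s => ?_⟩⟩
  have hss : conjugate (conjugate s) = s := star_star s
  simp only [Set.mem_setOf_eq, hss, not_lt]
  constructor
  · exact fun hlt => hlt.le
  · intro hle
    exact lt_of_le_of_ne hle fun heq => h s (f.injective heq).symm

omit [NumberField E] in
/-- **Every CM type has rank at least `2`** (any field with a complex embedding): the indicators of `Φ` and of `Φ̄`,
translates of `𝟙_Φ` by `1` and by complex conjugation, are linearly independent (`dim MT(A_Φ) ≥ 2`).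
[cite: Shimura1998, §32.9] [cite: Gordon1999HodgeAVSurvey, 7.5] -/
theorem two_le_cmTypeRank_of_cmType [Fintype (E →+* ℂ)] [Nonempty (E →+* ℂ)] (φ : CMType E) : 2 ≤ cmTypeRank φ := by
  obtain ⟨s₁⟩ : Nonempty (E →+* ℂ) := inferInstance
  -- an embedding inside `φ` and its conjugate outside
  obtain ⟨s₀, hs₀⟩ : ∃ s₀ : E →+* ℂ, s₀ ∈ φ.1 := by
    by_cases h : s₁ ∈ φ.1
    · exact ⟨s₁, h⟩
    · refine ⟨conjugate s₁, ?_⟩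
      by_contra h'
      exact h ((φ.2 s₁).2 h')
  have hs₀' : conjugate s₀ ∉ φ.1 := (φ.2 s₀).1 hs₀
  let v₁ : (E →+* ℂ) → ℚ := translateInd φ.1 (1 : ℂ ≃+* ℂ)
  let v₂ : (E →+* ℂ) → ℚ := translateInd φ.1 (starRingAut : ℂ ≃+* ℂ)
  have h11 : v₁ s₀ = 1 := translateInd_of_mem (by rwa [one_smul])
  have h12 : v₁ (conjugate s₀) = 0 := translateInd_of_not_mem (by rwa [one_smul])
  have h21 : v₂ s₀ = 0 := translateInd_of_not_mem (by rwa [conj_smul_eq_conjugate])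
  have h22 : v₂ (conjugate s₀) = 1 :=
    translateInd_of_mem (by rw [conj_smul_eq_conjugate]; change star (star s₀) ∈ φ.1; rwa [star_star])
  have hli : LinearIndependent ℚ ![v₁, v₂] := by
    refine LinearIndependent.pair_iff.2 fun c d hcd => ?_
    have e₁ := congrFun hcd s₀
    have e₂ := congrFun hcd (conjugate s₀)
    simp only [Pi.add_apply, Pi.smul_apply, smul_eq_mul,
      Pi.zero_apply, h11, h12, h21, h22, mul_one, mul_zero, add_zero, zero_add] at e₁ e₂
    exact ⟨e₁, e₂⟩
  have hle : Submodule.span ℚ (Set.range ![v₁, v₂]) ≤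
      Submodule.span ℚ (Set.range fun g : ℂ ≃+* ℂ => translateInd φ.1 g) := by
    rw [Submodule.span_le]
    rintro _ ⟨j, rfl⟩
    fin_cases j
    · exact Submodule.subset_span ⟨1, rfl⟩
    · exact Submodule.subset_span ⟨starRingAut, rfl⟩
  calc 2 = Fintype.card (Fin 2) := (Fintype.card_fin 2).symm
    _ = finrank ℚ (Submodule.span ℚ (Set.range ![v₁, v₂])) := (finrank_span_eq_card hli).symm
    _ ≤ cmTypeRank φ := Submodule.finrank_mono hle

end Generic

/-! ### §2 The trace field of a CM field against a normal field -/

section Trace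

variable {I : Type} {K : I → Type} [∀ i, Field (K i)] [∀ i, NumberField (K i)]

/-- **The trace field embeds into the normal partner**: `K_{i₁}` normal over `ℚ`, `T = a⁻¹(L₁) ≤ K_{i₀}`; then `a(T) ⊆
L₁ = b(K_{i₁})` for any `b`, so `b⁻¹ ∘ a` embeds `T` into `K_{i₁}`. [cite: Lang2002, V §2 Thm. 2.8 and VI §1 Thm. 1.12] -/
theorem nonempty_ringHom_trace_of_normal {i₀ i₁ : I} (hK₁ : Normal ℚ (K i₁)) (a : K i₀ →+* ℂ) :
    Nonempty (↥((normalClosure ℚ (K i₁) ℂ).comap a.toRatAlgHom) →+* K i₁) := by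
  obtain ⟨b⟩ : Nonempty (K i₁ →+* ℂ) := inferInstance
  have hL : normalClosure ℚ (K i₁) ℂ = b.toRatAlgHom.fieldRange := normalClosure_eq_fieldRange_of_normal b.toRatAlgHom
  let f : ↥((normalClosure ℚ (K i₁) ℂ).comap a.toRatAlgHom) →ₐ[ℚ] ℂ :=
    a.toRatAlgHom.comp ((normalClosure ℚ (K i₁) ℂ).comap a.toRatAlgHom).val
  have hf : ∀ k, f k ∈ b.toRatAlgHom.range := fun k => by
    have hk : a.toRatAlgHom (k : K i₀) ∈ normalClosure ℚ (K i₁) ℂ := k.2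
    exact hL.le hk
  exact ⟨((AlgEquiv.ofInjectiveField b.toRatAlgHom).symm.toAlgHom.comp (f.codRestrict b.toRatAlgHom.range hf)).toRingHom⟩

variable [∀ i, IsCMField (K i)]

/-- **No embedding of the trace field is real once one of its elements is moved by `ρ`**: every `s : T → ℂ` extends to
`K_{i₀}` (T1), and `conj (t k₀) = t k₀ ↔ k₀ ∈ K_{i₀}⁺`. [cite: Shimura1998, §18.2 Lemma (i)] [cite: Lang2002, V §2 Thm. 2.8] -/
theorem conjugate_ne_of_not_mem_maximalRealSubfield {i₀ : I} (T : IntermediateField ℚ (K i₀)) {k₀ : K i₀} (hk₀ : k₀ ∈ T)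
    (hreal : k₀ ∉ maximalRealSubfield (K i₀)) (s : ↥T →+* ℂ) : conjugate s ≠ s := by
  intro hs
  obtain ⟨t, ht⟩ := exists_comp_algebraMap_eq T s
  have h1 : starRingEnd ℂ (t k₀) = t k₀ := by
    have h2 := RingHom.congr_fun hs ⟨k₀, hk₀⟩
    rw [conjugate_coe_eq, ← ht, RingHom.comp_apply, IntermediateField.algebraMap_apply] at h2
    exact h2
  exact hreal ((conj_apply_eq_iff_mem_maximalRealSubfield t k₀).1 h1)

end Trace

/-! ### §3 The exact criterion -/

section Exact

variable {I : Type} [Fintype I] {K : I → Type} [∀ i, Field (K i)] [∀ i, NumberField (K i)] [∀ i, IsCMField (K i)]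

/-- **A moved trace element yields an interacting pair when the partner is normal.**  `K_{i₁}` normal over `ℚ`,
`a₀ : K_{i₀} → ℂ`, `k₀ ∈ a₀⁻¹(L₁)` with `ρ k₀ ≠ k₀`: there are CM types `Φ₀, Φ₁` with
`cmFamilyRank Φ + 2 < cmTypeRank Φ₀ + cmTypeRank Φ₁ + 1` (`Hg(A₀ × A₁) ⊊ Hg(A₀) × Hg(A₁)`) — the pair induced from a CM
type of the trace field. [cite: Gordon1999HodgeAVSurvey, 7.5–7.7 and 7.6.1] [cite: Shimura1998, §32.9] -/
theorem exists_cmFamilyRank_add_card_lt_of_not_mem_maximalRealSubfield {i₀ i₁ : I} (h01 : i₀ ≠ i₁)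
    (hI : ∀ l, l = i₀ ∨ l = i₁) (hK₁ : Normal ℚ (K i₁)) (a₀ : K i₀ →+* ℂ) {k₀ : K i₀}
    (hk₀ : a₀ k₀ ∈ normalClosure ℚ (K i₁) ℂ) (hreal : k₀ ∉ maximalRealSubfield (K i₀)) :
    ∃ Φ : ∀ i, CMType (K i), CMAlgebra.cmFamilyRank Φ + Fintype.card I < (∑ i, cmTypeRank (Φ i)) + 1 := by
  set T : IntermediateField ℚ (K i₀) := (normalClosure ℚ (K i₁) ℂ).comap a₀.toRatAlgHom with hT
  have hk₀T : k₀ ∈ T := hk₀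
  -- a CM type of the trace field
  obtain ⟨φ⟩ := nonempty_cmType_of_forall_conjugate_ne
    (conjugate_ne_of_not_mem_maximalRealSubfield T hk₀T hreal)
  -- embeddings of `T` into both fields
  obtain ⟨e₁⟩ := nonempty_ringHom_trace_of_normal hK₁ a₀
  let e₀ : ↥T →+* K i₀ := algebraMap ↥T (K i₀)
  let e : ∀ i, ↥T →+* K i := fun i =>
    if h : i = i₀ then h ▸ e₀ else ((hI i).resolve_left h) ▸ e₁
  refine ⟨fun i => inducedCMType (e i) φ, ?_⟩
  haveI : Nonempty I := ⟨i₀⟩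
  have hcard : Fintype.card I = 2 := by
    rw [← Finset.card_univ, show (Finset.univ : Finset I) = {i₀, i₁} from Finset.ext fun j => by
      simpa only [Finset.mem_univ, Finset.mem_insert, Finset.mem_singleton, true_iff] using hI j,
      Finset.card_pair h01]
  have hpair := cmTypeRank_add_cmTypeRank_inducedCMType_pair i₀ i₁ e φ
  have h2 := two_le_cmTypeRank_of_cmType φ
  rw [IrrOdd.sum_eq_add_of_pair _ hI h01, hcard, hpair]
  omega

/-- **THE EXACT TYPE-FREE CRITERION WHEN THE PARTNER IS GALOIS.**  `K_{i₁}` normal over `ℚ`, `a₀ : K_{i₀} → ℂ` any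
embedding.  Then `cmFamilyRank Φ + 2 = cmTypeRank Φ₀ + cmTypeRank Φ₁ + 1` holds for EVERY family of CM types `Φ` (i.e.
**`Hg(A₀ × A₁) = Hg(A₀) × Hg(A₁)` for all realisations**) **iff the trace field `a₀⁻¹(L₁)` lies in the maximal real
subfield `K_{i₀}⁺`** (iff `a₀(K_{i₀}) ∩ b(K_{i₁})` is fixed by complex conjugation).
[cite: Gordon1999HodgeAVSurvey, §3 Theorem (proof), 7.5–7.7 and 7.6.1] [cite: MoonenZarhin1999LowDim, Thm. (0.2)]
[cite: Shimura1998, §18.2 Lemma and §32.9] -/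
theorem forall_cmFamilyRank_add_card_eq_iff_trace_le_maximalRealSubfield {i₀ i₁ : I} (h01 : i₀ ≠ i₁)
    (hI : ∀ l, l = i₀ ∨ l = i₁) (hK₁ : Normal ℚ (K i₁)) (a₀ : K i₀ →+* ℂ) :
    (∀ Φ : ∀ i, CMType (K i), CMAlgebra.cmFamilyRank Φ + Fintype.card I = (∑ i, cmTypeRank (Φ i)) + 1) ↔
      ∀ k : K i₀, a₀ k ∈ normalClosure ℚ (K i₁) ℂ → k ∈ maximalRealSubfield (K i₀) := by
  constructor
  · intro hall k hk
    by_contra hreal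
    obtain ⟨Φ, hlt⟩ := exists_cmFamilyRank_add_card_lt_of_not_mem_maximalRealSubfield h01 hI hK₁ a₀ hk hreal
    exact absurd (hall Φ) hlt.ne
  · intro htr Φ
    exact cmFamilyRank_add_card_eq_pair_of_forall_mem_maximalRealSubfield_one h01 hI Φ a₀ htr

/-- **… equivalently, in `ℂ`: iff complex conjugation fixes `a₀(K_{i₀}) ∩ L₁` pointwise.**
[cite: Gordon1999HodgeAVSurvey, §3 Theorem (proof) and 7.5–7.7] [cite: Shimura1998, §18.2 Lemma] -/
theorem forall_cmFamilyRank_add_card_eq_iff_forall_conj_apply_eq {i₀ i₁ : I} (h01 : i₀ ≠ i₁)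
    (hI : ∀ l, l = i₀ ∨ l = i₁) (hK₁ : Normal ℚ (K i₁)) (a₀ : K i₀ →+* ℂ) :
    (∀ Φ : ∀ i, CMType (K i), CMAlgebra.cmFamilyRank Φ + Fintype.card I = (∑ i, cmTypeRank (Φ i)) + 1) ↔
      ∀ k : K i₀, a₀ k ∈ normalClosure ℚ (K i₁) ℂ → starRingEnd ℂ (a₀ k) = a₀ k := by
  rw [forall_cmFamilyRank_add_card_eq_iff_trace_le_maximalRealSubfield h01 hI hK₁ a₀]
  exact forall_congr' fun k => imp_congr_right fun _ => (conj_apply_eq_iff_mem_maximalRealSubfield a₀ k).symm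

/-- **Symmetric form: `K_{i₀}` normal.**  Additivity for all types iff the trace `b₀⁻¹(L₀) ≤ K_{i₁}` lies in `K_{i₁}⁺`.
[cite: Gordon1999HodgeAVSurvey, §3 Theorem (proof) and 7.5–7.7] -/
theorem forall_cmFamilyRank_add_card_eq_iff_trace_le_maximalRealSubfield' {i₀ i₁ : I} (h01 : i₀ ≠ i₁)
    (hI : ∀ l, l = i₀ ∨ l = i₁) (hK₀ : Normal ℚ (K i₀)) (b₀ : K i₁ →+* ℂ) :
    (∀ Φ : ∀ i, CMType (K i), CMAlgebra.cmFamilyRank Φ + Fintype.card I = (∑ i, cmTypeRank (Φ i)) + 1) ↔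
      ∀ k : K i₁, b₀ k ∈ normalClosure ℚ (K i₀) ℂ → k ∈ maximalRealSubfield (K i₁) :=
  forall_cmFamilyRank_add_card_eq_iff_trace_le_maximalRealSubfield h01.symm (fun l => (hI l).symm) hK₀ b₀

/-- **TWO GALOIS CM FIELDS: additivity for all types iff `a₀(K_{i₀}) ∩ b₀(K_{i₁}) ⊆ ℂ` is fixed by complex conjugation**
(the intersection of THE two subfields of `ℂ`). [cite: Gordon1999HodgeAVSurvey, §3 Theorem (proof) and 7.5–7.7]
[cite: MoonenZarhin1999LowDim, Thm. (0.2)] -/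
theorem forall_cmFamilyRank_add_card_eq_iff_of_normal_of_normal {i₀ i₁ : I} (h01 : i₀ ≠ i₁)
    (hI : ∀ l, l = i₀ ∨ l = i₁) (hK₁ : Normal ℚ (K i₁)) (a₀ : K i₀ →+* ℂ) (b₀ : K i₁ →+* ℂ) :
    (∀ Φ : ∀ i, CMType (K i), CMAlgebra.cmFamilyRank Φ + Fintype.card I = (∑ i, cmTypeRank (Φ i)) + 1) ↔
      ∀ z : ℂ, z ∈ a₀.toRatAlgHom.fieldRange → z ∈ b₀.toRatAlgHom.fieldRange → starRingEnd ℂ z = z := by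
  rw [forall_cmFamilyRank_add_card_eq_iff_forall_conj_apply_eq h01 hI hK₁ a₀,
    normalClosure_eq_fieldRange_of_normal b₀.toRatAlgHom]
  constructor
  · intro h z hz₀ hz₁
    obtain ⟨k, rfl⟩ := AlgHom.mem_fieldRange.1 hz₀
    exact h k hz₁
  · intro h k hk
    exact h _ (AlgHom.mem_fieldRange.2 ⟨k, rfl⟩) hk

/-- **Nondegeneracy form.**  `K_{i₁}` normal: `(Φ₀, Φ₁)` is a nondegenerate family for EVERY pair of nondegenerate types
iff the trace lies in `K_{i₀}⁺`; stated as: if the trace is not in `K_{i₀}⁺`, some pair of types is not additive, so the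
«nondegenerate iff both nondegenerate» equivalence of the real-trace criterion is genuinely conditional.  Here the
positive direction. [cite: Gordon1999HodgeAVSurvey, 7.5–7.6.1] -/
theorem isNondegenerateFamily_iff_forall_of_normal_of_trace {i₀ i₁ : I} (h01 : i₀ ≠ i₁) (hI : ∀ l, l = i₀ ∨ l = i₁)
    (a₀ : K i₀ →+* ℂ) (htr : ∀ k : K i₀, a₀ k ∈ normalClosure ℚ (K i₁) ℂ → k ∈ maximalRealSubfield (K i₀))
    (Φ : ∀ i, CMType (K i)) : CMAlgebra.IsNondegenerateFamily Φ ↔ ∀ i, IsNondegenerate (Φ i) :=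
  isNondegenerateFamily_iff_forall_of_forall_mem_maximalRealSubfield h01 hI Φ fun a k hk =>
    htr k ((apply_mem_normalClosure_iff i₁ a a₀ k).1 hk)

end Exact

/-! ### §4 Hodge side -/

section Hodge

variable {I : Type} [Fintype I] [DecidableEq I] {K : I → Type} [∀ i, Field (K i)] [∀ i, NumberField (K i)]
  [∀ i, IsCMField (K i)]

/-- **A moved trace element against a normal partner produces an exceptional MIXED Hodge class**: `K_{i₁}` normal,
`k₀ ∈ a₀⁻¹(L₁)` with `ρ k₀ ≠ k₀`; then there are CM types `Φ` such that for EVERY family of realisations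
`A_i ⊨ (K_i; Φ_i)` some `A_{π₁}^• × A_{π₂}^•` with disjoint slot maps carries a rational Hodge class that is not a
`ℂ`-combination of exterior products. [cite: MoonenZarhin1999LowDim, §3 (3.1)] [cite: Gordon1999HodgeAVSurvey, 7.5–7.7] -/
theorem exists_cmType_not_hodgeClassesProductSpan_of_not_mem_maximalRealSubfield {i₀ i₁ : I} (h01 : i₀ ≠ i₁)
    (hI : ∀ l, l = i₀ ∨ l = i₁) (hK₁ : Normal ℚ (K i₁)) (a₀ : K i₀ →+* ℂ) {k₀ : K i₀}
    (hk₀ : a₀ k₀ ∈ normalClosure ℚ (K i₁) ℂ) (hreal : k₀ ∉ maximalRealSubfield (K i₀)) :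
    ∃ Φ : ∀ i, CMType (K i), ∀ (A : I → AbelianVariety ℂ) (ιA : ∀ i, 𝓞 (K i) →+* End (A i))
      (θ : ∀ i, K i →+* Module.End ℂ (complexBetti (A i).X 1)),
      (∀ i, IsCMTypeRealisation (Φ i) (A i) (ιA i) (θ i)) →
        ∃ (N₁ N₂ : ℕ) (_ : NeZero N₁) (_ : NeZero N₂) (π₁ : Fin N₁ → I) (π₂ : Fin N₂ → I),
          (∀ j₁ j₂, π₁ j₁ ≠ π₂ j₂) ∧ ¬ HodgeClassesProductSpan (⨁ fun j => A (π₁ j)) (⨁ fun j => A (π₂ j)) := by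
  haveI : Nonempty I := ⟨i₀⟩
  obtain ⟨Φ, hlt⟩ := exists_cmFamilyRank_add_card_lt_of_not_mem_maximalRealSubfield h01 hI hK₁ a₀ hk₀ hreal
  exact ⟨Φ, fun A ιA θ hA => exists_not_hodgeClassesProductSpan_of_cmFamilyRank_add_card_ne hA hlt.ne⟩

end Hodge

end Summit.HodgeConjecture.CorCM

end
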